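import Literature.NumberTheory.EllipticCurves.SkinnerZhang2014.MultiplicativeIndivisibility
import Literature.NumberTheory.EllipticCurves.HeegnerPointsKolyvaginStructure
import HarnessLib

/-!
# Skinner–Zhang 2014 (arXiv:1407.1099, UNREFEREED), Theorem 1.3: the mod-`p` Kolyvagin system is
# non-zero at a prime `p ∥ N` (`p ≥ 5`) — transcribed at `N⁻ = 1` as an OPEN claim

HONEST FRAMING (cell `bsd-stepL`, seat `bsd-stepL-koly`, FULL-BSD rank ≤ 1 programme D-0033
tranche 1a, row B9 = N8 = X11b at `p ≥ 5`): Skinner–Zhang is a PREPRINT since 2014 (arXiv v1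
only; sibling file `MultiplicativeIndivisibility.lean` records the status check); under the tree's
rules its statements are `def … : Prop` CLAIMS tagged `[claim: …, status: under-review]` with the
suffix `_OPEN`, taken as explicit hypotheses — never theorems. This file adds Theorem 1.3 (the
sibling deliberately left it out: "whose objects (mod-`p` Kolyvagin systems on Shimura curves) the
tree spells in `HeegnerPointsKolyvaginStructure`" — the tree now HAS that currency:
`BurungaleEtAl2026_exists_kolyvaginClass_ne_zero`, `WZhang2014_exists_kolyvaginClass_one_ne_zero`),
in the special case `N⁻ = 1` (the modular curve `X₀(N)`; the tree has no Kolyvagin data on Shimura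
curves). Consumer of record: `Summit.BirchSwinnertonDyer.Rank1Residual.X11b.Three.Koly.
indexLowerBoundAt_of_kolyvaginClass_one_ne_zero_of_mccallum` (any odd `p`: a non-zero `c_1(n)`
gives STEP L `X11b.IndexLowerBoundAt W p K y_K`), file `X11b/Three/KolyvaginNonvanishing.lean`.

Printed text (arXiv:1407.1099v1 §1, held `paper:arxiv-1407.1099` p0003 L57–L100): "Let
`Ram(ρ̄_{E,p})` be the set of primes `ℓ ∥ N`, `ℓ ≠ p`, such that `ρ̄_{E,p}` is ramified at `ℓ`
(equivalently, `p ∤ ord_ℓ(Δ)`). Write `N = N⁺N⁻` where the prime factors of `N⁺` (resp. `N⁻`) are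
all split (resp. inert) in `K`. In particular, `p ∣ N⁺`. … Hypothesis ♠ (1) `N⁻` is squarefree
(`N⁻ = 1` is allowed). (2) `Ram(ρ̄_{E,p})` contains all primes `ℓ ≠ p` such that `ℓ ∥ N⁺` and all
primes `ℓ ∣ N⁻` such that `ℓ ≡ ±1 (mod p)`. (3) `Ram(ρ̄_{E,p}) ≠ ∅`, and either `Ram(ρ̄_{E,p})`
contains a prime `ℓ ∣ N⁻` or there are at least two primes factors `ℓ ∥ N⁺`. … **Theorem 1.3.** Let
`E/ℚ` be an elliptic curve of conductor `N` and minimal discriminant `Δ`, and let `p` be a prime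
such that `p ∥ N`. Let `K = ℚ[√−D]` be an imaginary quadratic field such that `(D, N) = 1`. If
(a) `p ≥ 5` and `p` splits in `K`; (b) `ρ̄_{E,p}` is an irreducible `Gal(ℚ̄/ℚ)`-representation;
(c) `ρ̄_{E,p}` is not finite at `p`, and if `E` has split multiplicative reduction at `p` then
`log_p q_E ∈ pℤ_p^×`, where `q_E ∈ ℚ_p^×` is the Tate period of `E/ℚ_p`; (d) Hypothesis ♠ holds
for `(E, p, K)` with `N⁻` a product of an even number of primes (`N⁻ = 1` is allowed), then
`κ = {c(n,1) ∈ H¹(K, E[p]) : n ∈ Λ} ≠ {0}`. In particular, `κ^∞ ≠ {0}`. Here `κ` is the mod `p`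
Kolyvagin system arising from Heegner points over ray class fields of `K` on a certain Shimura
curve associated with the factorization `N = N⁺N⁻`."

## Transcription at `N⁻ = 1` (conventions of the sibling and of the Zhang / BCGS facts)

* `W` globally minimal (`N = W.conductorNorm ℤ`, `Δ = W.minimalDiscriminantInt`), `p ∥ N` =
  multiplicative reduction at `p`; (a) `5 ≤ p`; "`p` splits in `K`" and "`(D, N) = 1`" are implied
  by `N⁻ = 1` = `SatisfiesHeegnerHypothesis N K` (every `ℓ ∣ N`, so `p` too, splits in `K`).
* (b) `W.HasIrreducibleModPGaloisRep p`. (c) "not finite at `p`" ⟺ `p ∤ ord_p(Δ)` (the authors'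
  own gloss, §1 p. 1, transcribed in the sibling's `Hypotheses.not_dvd_ord_disc`) and the split
  clause exactly as the sibling's `Hypotheses.log_tatePeriod` (`ord_p(log_p q_E) = 1` for every
  Tate parameter datum).
* (d) at `N⁻ = 1`: ♠(1) void; ♠(2) = every multiplicative `ℓ ≠ p` has `p ∤ v_ℓ(Δ)`; ♠(3) =
  `Ram ≠ ∅`, i.e. some multiplicative `ℓ ≠ p` with `p ∤ v_ℓ(Δ)` (then `p` and `ℓ` are two primes
  `∥ N⁺`).
* Conclusion: in the currency of `BurungaleEtAl2026_exists_kolyvaginClass_ne_zero` /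
  `WZhang2014_exists_kolyvaginClass_one_ne_zero` — a parametrisation datum `Dt` of level `N`, an
  orientation `β`, `ι : K → ℂ`, `n ∈ Λ` (`KolSupp (Zhang2014.IsKolyvaginPrime N W K p) n`, so
  `1 ≤ M(n)`) and a Kolyvagin–Heegner datum `d` of conductor `n` with `c_1(n) = d.kolyvaginClass _ 1`
  NON-ZERO. `-- TODO(general form): N⁻ square-free with an even number of prime factors.`

Deliberately NOT here: Thm 1.1 (the `p`-converse) and Thm 1.2 (sibling file); Thms 11.1/12.1 for
general newforms `g`.
-/

noncomputable section

open scoped Classical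

open WeierstrassCurve

namespace Literature.NumberTheory.EllipticCurves.SkinnerZhang2014

open Literature.NumberTheory.EllipticCurves Literature.NumberTheory.EllipticCurves.ModularForms

/-- **OPEN HYPOTHESIS — UNREFEREED PREPRINT (arXiv:1407.1099v1, 2014).** Skinner–Zhang,
*Indivisibility of Heegner points in the multiplicative case*, Thm. 1.3 (§1), at `N⁻ = 1`, verbatim
in the module docstring: for `E/ℚ` with `p ∥ N`, `p ≥ 5`, `ρ̄_{E,p}` irreducible and not finite
at `p` (+ the split `𝓛`-clause), Hypothesis ♠ (every multiplicative `ℓ ≠ p` ramified mod `p`, and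
`Ram ≠ ∅`), and `K` imaginary quadratic in which every prime factor of `N` splits: the mod-`p`
Kolyvagin system `{c(n,1)}` of Heegner points on `X₀(N)` is NON-ZERO — some `c_1(n) ≠ 0`,
`n ∈ Λ`. Transcription conventions: sibling `Hypotheses` ((a)–(c)) and the tree's Kolyvagin facts
(conclusion). NEVER cite this `Prop` as a theorem: take it as an explicit hypothesis; a result using
it is conditional on an unrefereed claim. [claim: SkinnerZhang2014, status: under-review] -/
def thm1_3_exists_kolyvaginClass_one_ne_zero_OPEN : Prop :=
  ∀ (W : WeierstrassCurve ℚ) [W.IsElliptic] [W.IsGloballyMinimal] (p : ℕ) [hp : Fact p.Prime],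
    5 ≤ p → W.HasMultiplicativeReductionAtPrime p →
    W.HasIrreducibleModPGaloisRep p →
    ¬ p ∣ padicValInt p W.minimalDiscriminantInt →
    (W.HasSplitMultiplicativeReductionAtPrime p →
      ∀ D : TateParameterData W p, (padicLog p D.q).valuation = 1) →
    (∀ (ℓ : ℕ) [Fact ℓ.Prime], ℓ ≠ p → W.HasMultiplicativeReductionAtPrime ℓ →
      ¬ p ∣ padicValInt ℓ W.minimalDiscriminantInt) →
    (∃ (ℓ : ℕ) (_ : Fact ℓ.Prime), ℓ ≠ p ∧ W.HasMultiplicativeReductionAtPrime ℓ ∧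
      ¬ p ∣ padicValInt ℓ W.minimalDiscriminantInt) →
    ∀ (K : Type) [Field K] [NumberField K], IsImaginaryQuadratic K →
      ∀ [NeZero (W.conductorNorm ℤ)], SatisfiesHeegnerHypothesis (W.conductorNorm ℤ) K →
      ∃ (Dt : ModularParametrizationData W (W.conductorNorm ℤ)) (β : ℤ) (ι : K →+* ℂ) (n : ℕ)
        (d : KolyvaginHeegnerData Dt β ι n),
        KolyvaginDescent.KolSupp (Zhang2014.IsKolyvaginPrime (W.conductorNorm ℤ) W K p) n ∧
          (1 : ℕ∞) ≤ Zhang2014.levelIndex W p n ∧ d.kolyvaginClass hp.out 1 ≠ 0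

/-- Under the claim, the hypotheses (a)–(e) of the sibling's `Hypotheses W p` structure (SZ Thm 1.1)
together with ♠(2) give the conclusion of Thm 1.3 at `N⁻ = 1`: (e) supplies the `Ram ≠ ∅` witness
`ℓ ≠ p` (`Hypotheses.exists_ramified_ne`). Bookkeeping between the two SZ transcriptions; conditional
on the claim `h`. [claim: SkinnerZhang2014, status: under-review] -/
theorem exists_kolyvaginClass_one_ne_zero_of_hypotheses
    (h : thm1_3_exists_kolyvaginClass_one_ne_zero_OPEN)
    (W : WeierstrassCurve ℚ) [W.IsElliptic] [W.IsGloballyMinimal] (p : ℕ) [hp : Fact p.Prime]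
    (hp5 : 5 ≤ p) (hH : Hypotheses W p)
    (hram : ∀ (ℓ : ℕ) [Fact ℓ.Prime], ℓ ≠ p → W.HasMultiplicativeReductionAtPrime ℓ →
      ¬ p ∣ padicValInt ℓ W.minimalDiscriminantInt)
    (K : Type) [Field K] [NumberField K] (hK : IsImaginaryQuadratic K)
    [NeZero (W.conductorNorm ℤ)] (hHeeg : SatisfiesHeegnerHypothesis (W.conductorNorm ℤ) K) :
    ∃ (Dt : ModularParametrizationData W (W.conductorNorm ℤ)) (β : ℤ) (ι : K →+* ℂ) (n : ℕ)
      (d : KolyvaginHeegnerData Dt β ι n),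
      KolyvaginDescent.KolSupp (Zhang2014.IsKolyvaginPrime (W.conductorNorm ℤ) W K p) n ∧
        (1 : ℕ∞) ≤ Zhang2014.levelIndex W p n ∧ d.kolyvaginClass hp.out 1 ≠ 0 := by
  obtain ⟨ℓ, iℓ, hne, hmℓ, hrℓ⟩ := hH.exists_ramified_ne
  exact h W p hp5 hH.mult hH.irr hH.not_dvd_ord_disc hH.log_tatePeriod
    (fun ℓ' _ hne' hm' ↦ hram ℓ' hne' hm') ⟨ℓ, iℓ, hne, hmℓ, hrℓ⟩ K hK hHeeg

end Literature.NumberTheory.EllipticCurves.SkinnerZhang2014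

end
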